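import Summits.Ventures.QEC.Census.CSSNormalFormSAT.CubeRefute
import Summits.Ventures.QEC.Census.CSSNormalFormSAT.CoverB8W7
import HarnessLib

/-!
# No Boolean `k = 1` normal form at `(16,5)` for the split `(b,w) = (8,7)` (KERNEL-PLAN item 5, cube-covered cases, part B)

Through the 11-leaf cube cover `CoverB8W7` and `false_of_cubeCover`. Theorems only; axioms standard. [folklore]
-/

set_option autoImplicit false

namespace Summit.Ventures.QEC.Census.CSSNormalFormSAT

/-- No Boolean normal form for `(b,w) = (8,7)`. [folklore] -/
theorem noNF_16_5_b8_w7 (P : ℕ → ℕ → Bool) (hZ : ZCond ⟨16, 5, 8, 7⟩ P) (hX : XCond ⟨16, 5, 8, 7⟩ P)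
    (hL : LexCond ⟨16, 5, 8, 7⟩ P) : False :=
  false_of_cubeCover ⟨16, 5, 8, 7⟩ P (by decide) (by decide) hZ hX hL treeB8W7 treeB8W7_wf unsat_nf16_b8_w7_of_leaf

end Summit.Ventures.QEC.Census.CSSNormalFormSAT
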